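import Mathlib
import Summits.KontsevichZagierPeriods.KontsevichZagierPeriods.Theses.InverseLandau
import Summits.KontsevichZagierPeriods.KontsevichZagierPeriods.Theorems.InverseLandauTateLiftingRatPolyDense
import Summits.KontsevichZagierPeriods.KontsevichZagierPeriods.Theorems.InverseLandauTateLiftingPolynomialArc
import Summits.KontsevichZagierPeriods.KontsevichZagierPeriods.Theorems.InverseLandauTateLiftingCornerShift
import Summits.KontsevichZagierPeriods.KontsevichZagierPeriods.Theorems.InverseLandauTateLiftingTateSubst
import Summits.KontsevichZagierPeriods.KontsevichZagierPeriods.Theorems.InverseLandauTateLiftingArcSpecialisation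
import Summits.KontsevichZagierPeriods.KontsevichZagierPeriods.Theorems.InverseLandauTateLiftingLogIntegral
import Summits.KontsevichZagierPeriods.KontsevichZagierPeriods.Theorems.InverseLandauTateLiftingBakerDecomposition
import Summits.KontsevichZagierPeriods.KontsevichZagierPeriods.Theorems.InverseLandauTateLiftingTorusFibre
import Summits.KontsevichZagierPeriods.KontsevichZagierPeriods.Theorems.InverseLandauTateLiftingZsmulRep
import Summits.KontsevichZagierPeriods.KontsevichZagierPeriods.Theorems.InverseLandauTateLiftingLogSectorAssembly

/-!
# `TateLifting` (stmt-KontsevichZagierPeriods-9129), line `Sketch` — the weight-one sector, unconditionally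

`TateLifting` HOLDS ON THE LOG SECTOR: every `ℤ`-combination `Σ mᵢ [rᵢ]` of honest unfolded
logarithms `[rᵢ] = [(0,1), βᵢ (αᵢ − 1)/(1 + (αᵢ − 1) z₀)]` (`αᵢ > 0`; `αᵢ, βᵢ` real algebraic;
value `βᵢ log αᵢ`) with vanishing evaluation lies in `KZ.relations ⊔ closure T`, `T` the crux's
generating set of Tate fibres — and in fact in `KZ.relations ⊔ closure 𝒢` with EXPLICIT generic
fibres: monomial parametrisations of relation tori. Ingredients (all landed stubs of the line):
Baker's theorem (`baker_holds` ⟶ `tateLifting_bakerDecomposition`), the log unfolding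
(`tateLifting_logIntegral`), the torus fibre (`tateLifting_torusFibre`), integer multiples
(`tateLifting_zsmulRep`), the assembly (`tateLifting_logSectorAssembly`), and the transfer
`𝒢 ⊆ T` (`tateLifting_genFibres_subset_tateFibres`). This is the sector of the crux where
transcendence theory reaches today; the residual generation statement `GenLifting` (stub 6) is what
remains conjecture-grade.
-/

noncomputable section

namespace Summit.KontsevichZagierPeriods.InverseLandau

open Literature.NumberTheory.Transcendental

/-- **`TateLifting` on the log sector** (unconditional): a vanishing `ℤ`-combination of honest
unfolded logarithms `[(0,1), βᵢ (αᵢ−1)/(1+(αᵢ−1)z₀)]` (`αᵢ > 0`; `αᵢ, βᵢ` real algebraic) lies in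
`KZ.relations ⊔ closure T`, `T` the generating set of the crux `TateLifting` (fibres at real-algebraic
parameters of one-parameter rational Tate families over `ℚ`, admissible and identically vanishing).
[cite: Baker1975, Thm 2.1] -/
theorem TateLifting_logSector :
    ∀ (s : ℕ) (α β : Fin s → ℝ) (m : Fin s → ℤ) (r : Fin s → KZ.IntegralRep 1),
      (∀ i, 0 < α i) → (∀ i, IsAlgebraic ℚ (α i)) → (∀ i, IsAlgebraic ℚ (β i)) →
      (∀ i, (r i).domain = Set.pi Set.univ (fun _ : Fin 1 => Set.Ioo (0 : ℝ) 1)) →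
      (∀ i, Set.EqOn (r i).integrand
        (fun z => β i * ((α i - 1) / (1 + (α i - 1) * z 0))) (r i).domain) →
      KZ.eval (∑ i, m i • KZ.of (r i)) = 0 →
      ∑ i, m i • KZ.of (r i) ∈ KZ.relations ⊔ AddSubgroup.closure
        {d : KZ.FormalRep | ∃ (n : ℕ) (P Q : MvPolynomial (Fin (n + 1)) ℚ) (ε ϖ₀ : ℝ)
            (r : KZ.IntegralRep n), 0 < ε ∧
          (∃ c₀ : ℚ, c₀ ≠ 0 ∧ ∀ z : Fin n → ℝ,
            MvPolynomial.aeval (Fin.snoc z (0 : ℝ) : Fin (n + 1) → ℝ) Q = (c₀ : ℝ)) ∧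
          (∀ (z : Fin n → ℝ) (ϖ : ℝ), (∀ i, z i ∈ Set.Icc (0 : ℝ) 1) → ϖ ∈ Set.Ioo 0 ε →
            MvPolynomial.aeval (Fin.snoc z ϖ : Fin (n + 1) → ℝ) Q ≠ 0) ∧
          (∀ ϖ ∈ Set.Ioo (0 : ℝ) ε, ∫ z in Set.pi Set.univ (fun _ : Fin n => Set.Ioo (0 : ℝ) 1),
            MvPolynomial.aeval (Fin.snoc z ϖ : Fin (n + 1) → ℝ) P /
              MvPolynomial.aeval (Fin.snoc z ϖ : Fin (n + 1) → ℝ) Q = 0) ∧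
          IsAlgebraic ℚ ϖ₀ ∧ ϖ₀ ∈ Set.Ioo 0 ε ∧
          r.domain = Set.pi Set.univ (fun _ : Fin n => Set.Ioo (0 : ℝ) 1) ∧
          Set.EqOn r.integrand (fun z => MvPolynomial.aeval (Fin.snoc z ϖ₀ : Fin (n + 1) → ℝ) P /
            MvPolynomial.aeval (Fin.snoc z ϖ₀ : Fin (n + 1) → ℝ) Q) r.domain ∧
          d = KZ.of r} :=
  fun s α β m r hα hαa hβa hdom hint hev =>
    sup_le le_sup_left
      ((AddSubgroup.closure_mono
        (tateLifting_arcSpecialisation tateLifting_cornerShift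
          (tateLifting_polynomialArc tateLifting_ratPolyDense) tateLifting_tateSubst)).trans
        le_sup_right)
      (tateLifting_logSectorAssembly tateLifting_bakerDecomposition tateLifting_logIntegral
        (tateLifting_torusFibre tateLifting_logIntegral) tateLifting_zsmulRep
        s α β m r hα hαa hβa hdom hint hev)

end Summit.KontsevichZagierPeriods.InverseLandau

end
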